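import Summits.CriticalPhenomena.PercolationContinuityZ3.Theses.PercNonProliferation
import Literature.Probability.Percolation.SharpnessDCTProofs

/-!
# Negative / tightness lemmas for the crux `FreeBoxPowerSaving` (stmt-CriticalPhenomena-4447), I

Supports (does not close) the crux `PercNonProliferation.FreeBoxPowerSaving`
(`∃ a C, 0 < a ∧ ∀ n ≥ 1, FA₂(p_c, n) ≤ C n^{-a}` with
`FA₂(p, n) := |B(n)|⁻² Σ_{x,y ∈ B(n)} P_p(x ↔ y inside B(n))` on `ℤ³`).  Landed from the
standing disprover's work file `Cruxes/FreeBoxPowerSaving/Disproof.lean`; sorry-free.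

* `freeBoxPowerSaving_iff_fa2` — the crux is the displayed statement about `fa2 (criticalProbI 3)`.
* Sandwich: `inv_card_le_fa2`, `fa2_le_one`, `fa2_ge_cube` (`FA₂ ≥ n^{-3}/27`).
* LOAD-BEARING: `false_without_guard` (with `∀ n`, i.e. `n = 0` allowed, the statement is false for
  every `p`: `0 ^ (-a) = 0`), `false_at_one` (the `p = 1` analogue is false: `FA₂(1, n) = 1`, so a
  proof must use criticality of the parameter, not lattice geometry alone).
* TIGHTNESS at every `p`: `exponent_le_three` (diagonal), `not_forall_exponent`.
* NORMAL FORMS: `not_of_frequently` (a refutation must show sub-power decay infinitely often),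
  `not_of_const_le`, `of_eventually` (an eventual bound suffices for provers).

Part II (`FreeBoxPowerSavingExponentLeTwo.lean`) adds the `p_c`-specific ceiling `a ≤ 2`.
-/

namespace Summit.CriticalPhenomena.PercolationContinuityZ3.FreeBoxPowerSavingNegative

open MeasureTheory ProbabilityTheory Filter
open Literature.Probability.Percolation Literature.Probability.LatticeModels
open Summit.CriticalPhenomena.PercolationContinuityZ3.Theses.PercNonProliferation
open scoped BigOperators Topology

noncomputable section

/-! ## The quantity `fa2 p n = FA₂(p, n)` -/

/-- `S_p(n) = Σ_{x,y ∈ B(n)} P_p(x ↔ y inside B(n))` (free-box pair sum, bond percolation on `ℤ³`). -/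
def pairSum (p : unitInterval) (n : ℕ) : ℝ :=
  ∑ x ∈ box 3 n, ∑ y ∈ box 3 n,
    (bondPercolation (zdGraph 3) p).real (openConnIn (↑(box 3 n) : Set (Site 3)) x y)

/-- `FA₂(p, n) = S_p(n) / |B(n)|²`. -/
def fa2 (p : unitInterval) (n : ℕ) : ℝ := pairSum p n / ((box 3 n).card : ℝ) ^ 2

/-- The crux, displayed over `fa2`. -/
theorem freeBoxPowerSaving_iff_fa2 :
    FreeBoxPowerSaving ↔
      ∃ a C : ℝ, 0 < a ∧ ∀ n : ℕ, 1 ≤ n → fa2 (criticalProbI 3) n ≤ C * (n : ℝ) ^ (-a) :=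
  Iff.rfl

/-- `S_p(n) ≥ 0`. -/
theorem pairSum_nonneg (p : unitInterval) (n : ℕ) : 0 ≤ pairSum p n :=
  Finset.sum_nonneg fun _ _ => Finset.sum_nonneg fun _ _ => measureReal_nonneg

/-- `|B(n)| > 0` (as a real number). -/
theorem card_box_pos (n : ℕ) : (0 : ℝ) < ((box 3 n).card : ℝ) := by
  exact_mod_cast (box_nonempty 3 n).card_pos

/-- `|B(n)| = (2n+1)³` (as a real number). -/
theorem card_box_real (n : ℕ) : ((box 3 n).card : ℝ) = (2 * (n : ℝ) + 1) ^ 3 := by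
  rw [card_box]; push_cast; ring

/-- `FA₂ ≥ 0`. -/
theorem fa2_nonneg (p : unitInterval) (n : ℕ) : 0 ≤ fa2 p n :=
  div_nonneg (pairSum_nonneg p n) (pow_pos (card_box_pos n) 2).le

/-- `S_p(n) ≤ |B(n)|²`. -/
theorem pairSum_le (p : unitInterval) (n : ℕ) : pairSum p n ≤ ((box 3 n).card : ℝ) ^ 2 := by
  unfold pairSum
  calc ∑ x ∈ box 3 n, ∑ y ∈ box 3 n,
        (bondPercolation (zdGraph 3) p).real (openConnIn (↑(box 3 n) : Set (Site 3)) x y)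
      ≤ ∑ x ∈ box 3 n, ∑ y ∈ box 3 n, (1 : ℝ) :=
        Finset.sum_le_sum fun x _ => Finset.sum_le_sum fun y _ => measureReal_le_one
    _ = ((box 3 n).card : ℝ) ^ 2 := by simp [sq]

/-- `FA₂ ≤ 1`. -/
theorem fa2_le_one (p : unitInterval) (n : ℕ) : fa2 p n ≤ 1 := by
  unfold fa2
  rw [div_le_one (pow_pos (card_box_pos n) 2)]
  exact pairSum_le p n

/-- `{x ↔ x in S}` is the sure event when `x ∈ S`. -/
theorem openConnIn_self_eq_univ {S : Set (Site 3)} {x : Site 3} (hx : x ∈ S) :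
    openConnIn S x x = Set.univ :=
  Set.eq_univ_of_forall fun _ => ⟨hx, hx, SimpleGraph.Reachable.refl _⟩

/-- Diagonal: `|B(n)| ≤ S_p(n)`. -/
theorem card_le_pairSum (p : unitInterval) (n : ℕ) : ((box 3 n).card : ℝ) ≤ pairSum p n := by
  unfold pairSum
  have h1 : ∀ x ∈ box 3 n, (1 : ℝ) ≤ ∑ y ∈ box 3 n,
      (bondPercolation (zdGraph 3) p).real (openConnIn (↑(box 3 n) : Set (Site 3)) x y) := by
    intro x hx
    calc (1 : ℝ) = (bondPercolation (zdGraph 3) p).real (openConnIn (↑(box 3 n) : Set (Site 3)) x x) := by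
          rw [openConnIn_self_eq_univ (Finset.mem_coe.2 hx), probReal_univ]
      _ ≤ _ := Finset.single_le_sum (f := fun y =>
          (bondPercolation (zdGraph 3) p).real (openConnIn (↑(box 3 n) : Set (Site 3)) x y))
          (fun y _ => measureReal_nonneg) hx
  calc ((box 3 n).card : ℝ) = ∑ x ∈ box 3 n, (1 : ℝ) := by simp
    _ ≤ _ := Finset.sum_le_sum h1

/-- `|B(n)|⁻¹ ≤ FA₂(p, n)`. -/
theorem inv_card_le_fa2 (p : unitInterval) (n : ℕ) : ((box 3 n).card : ℝ)⁻¹ ≤ fa2 p n := by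
  have hc := card_box_pos n
  unfold fa2
  rw [le_div_iff₀ (pow_pos hc 2), sq, ← mul_assoc, inv_mul_cancel₀ hc.ne', one_mul]
  exact card_le_pairSum p n

/-- `FA₂(p, n) ≥ n^{-3}/27` for `n ≥ 1`. -/
theorem fa2_ge_cube (p : unitInterval) {n : ℕ} (hn : 1 ≤ n) :
    1 / (27 * (n : ℝ) ^ 3) ≤ fa2 p n := by
  have hn' : (1 : ℝ) ≤ n := by exact_mod_cast hn
  have h3 : 2 * (n : ℝ) + 1 ≤ 3 * n := by linarith
  have hcard : ((box 3 n).card : ℝ) ≤ 27 * (n : ℝ) ^ 3 := by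
    rw [card_box_real]
    calc (2 * (n : ℝ) + 1) ^ 3 ≤ (3 * n) ^ 3 := by gcongr
      _ = 27 * (n : ℝ) ^ 3 := by ring
  calc 1 / (27 * (n : ℝ) ^ 3) ≤ 1 / ((box 3 n).card : ℝ) :=
        one_div_le_one_div_of_le (card_box_pos n) hcard
    _ = ((box 3 n).card : ℝ)⁻¹ := one_div _
    _ ≤ fa2 p n := inv_card_le_fa2 p n

/-- `FA₂(p, 0) = 1`. -/
theorem fa2_zero (p : unitInterval) : fa2 p 0 = 1 := by
  apply le_antisymm (fa2_le_one p 0)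
  have h := inv_card_le_fa2 p 0
  rw [card_box] at h
  simpa using h

/-! ## Load-bearing parts of the statement -/

/-- **The guard `1 ≤ n` is load-bearing**: with `∀ n` the statement is false for every `p`
(`(0:ℝ) ^ (-a) = 0` while `FA₂(p, 0) = 1`). -/
theorem false_without_guard (p : unitInterval) :
    ¬ ∃ a C : ℝ, 0 < a ∧ ∀ n : ℕ, fa2 p n ≤ C * (n : ℝ) ^ (-a) := by
  rintro ⟨a, C, ha, h⟩
  have h0 := h 0
  rw [fa2_zero, Nat.cast_zero, Real.zero_rpow (by linarith : (-a) ≠ 0), mul_zero] at h0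
  linarith

/-- At `p = 1` the percolation measure is the Dirac mass at `E(ℤ³)` (`setBernoulli_one`). -/
theorem bondPercolation_one : bondPercolation (zdGraph 3) 1 = Measure.dirac (zdGraph 3).edgeSet := by
  rw [bondPercolation]; exact setBernoulli_one _

/-- With all lattice edges open, any two sites of `B(n)` are joined inside `B(n)`. -/
theorem edgeSet_mem_openConnIn_box {n : ℕ} {x y : Site 3} (hx : x ∈ box 3 n) (hy : y ∈ box 3 n) :
    (zdGraph 3).edgeSet ∈ openConnIn (↑(box 3 n) : Set (Site 3)) x y := by
  refine ⟨hx, hy, ?_⟩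
  have hG : openGraph ((zdGraph 3).edgeSet) = zdGraph 3 := SimpleGraph.fromEdgeSet_edgeSet _
  rw [hG]
  exact (box_induce_reachable_zero n hx).trans (box_induce_reachable_zero n hy).symm

/-- `P_1(x ↔ y in B(n)) = 1` for `x, y ∈ B(n)`. -/
theorem real_openConnIn_one {n : ℕ} {x y : Site 3} (hx : x ∈ box 3 n) (hy : y ∈ box 3 n) :
    (bondPercolation (zdGraph 3) 1).real (openConnIn (↑(box 3 n) : Set (Site 3)) x y) = 1 := by
  rw [bondPercolation_one, measureReal_def, Measure.dirac_apply_of_mem (edgeSet_mem_openConnIn_box hx hy),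
    ENNReal.toReal_one]

/-- `FA₂(1, n) = 1`. -/
theorem fa2_one (n : ℕ) : fa2 1 n = 1 := by
  have hsum : pairSum 1 n = ((box 3 n).card : ℝ) ^ 2 := by
    unfold pairSum
    rw [Finset.sum_congr rfl fun x hx => Finset.sum_congr rfl fun y hy => real_openConnIn_one hx hy]
    simp [sq]
  unfold fa2
  rw [hsum, div_self (pow_ne_zero _ (card_box_pos n).ne')]

/-- **What a refutation must show**: sub-power decay of `FA₂(p, ·)` infinitely often. -/
theorem not_of_frequently {p : unitInterval}
    (h : ∀ a : ℝ, 0 < a → ∃ᶠ n : ℕ in atTop, (n : ℝ) ^ (-a) ≤ fa2 p n) :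
    ¬ ∃ a C : ℝ, 0 < a ∧ ∀ n : ℕ, 1 ≤ n → fa2 p n ≤ C * (n : ℝ) ^ (-a) := by
  rintro ⟨a, C, ha, hC⟩
  have ha2 : 0 < a / 2 := by linarith
  have hev1 : ∀ᶠ n : ℕ in atTop, C < (n : ℝ) ^ (a / 2) :=
    ((tendsto_rpow_atTop ha2).comp tendsto_natCast_atTop_atTop).eventually_gt_atTop C
  obtain ⟨n, hn, hnC, hn1⟩ := ((h (a / 2) ha2).and_eventually (hev1.and (eventually_ge_atTop 1))).exists
  have hnpos : (0 : ℝ) < n := by exact_mod_cast hn1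
  have key : (n : ℝ) ^ (-(a / 2)) ≤ C * (n : ℝ) ^ (-a) := hn.trans (hC n hn1)
  have hna : 0 < (n : ℝ) ^ a := Real.rpow_pos_of_pos hnpos a
  rw [Real.rpow_neg hnpos.le a, ← div_eq_mul_inv, le_div_iff₀ hna] at key
  have hsplit : (n : ℝ) ^ (-(a / 2)) * (n : ℝ) ^ a = (n : ℝ) ^ (a / 2) := by
    rw [← Real.rpow_add hnpos]; congr 1; ring
  rw [hsplit] at key
  linarith

/-- A uniform positive lower bound kills every power saving. -/
theorem not_of_const_le {p : unitInterval} {c : ℝ} (hc : 0 < c)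
    (h : ∀ n : ℕ, 1 ≤ n → c ≤ fa2 p n) :
    ¬ ∃ a C : ℝ, 0 < a ∧ ∀ n : ℕ, 1 ≤ n → fa2 p n ≤ C * (n : ℝ) ^ (-a) := by
  refine not_of_frequently fun a ha => ?_
  have hev : ∀ᶠ n : ℕ in atTop, (n : ℝ) ^ (-a) ≤ c := by
    have ht : Tendsto (fun n : ℕ => (n : ℝ) ^ (-a)) atTop (𝓝 0) :=
      (tendsto_rpow_neg_atTop ha).comp tendsto_natCast_atTop_atTop
    exact ht.eventually (eventually_le_nhds hc)
  exact ((hev.and (eventually_ge_atTop 1)).mono fun n hn => hn.1.trans (h n hn.2)).frequently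

/-- **`p = p_c` is load-bearing**: the `p = 1` analogue of the crux is false (`FA₂(1, ·) ≡ 1`). -/
theorem false_at_one :
    ¬ ∃ a C : ℝ, 0 < a ∧ ∀ n : ℕ, 1 ≤ n → fa2 1 n ≤ C * (n : ℝ) ^ (-a) :=
  not_of_const_le one_pos fun n _ => (fa2_one n).ge

/-! ## Tightness of the exponent at every `p`: `a ≤ 3` -/

/-- **No exponent `a > 3`, at any parameter** (diagonal terms alone). -/
theorem exponent_le_three (p : unitInterval) {a C : ℝ}
    (hC : ∀ n : ℕ, 1 ≤ n → fa2 p n ≤ C * (n : ℝ) ^ (-a)) : a ≤ 3 := by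
  by_contra ha
  push Not at ha
  have ha3 : 0 < a - 3 := by linarith
  have hev1 : ∀ᶠ n : ℕ in atTop, 27 * C < (n : ℝ) ^ (a - 3) :=
    ((tendsto_rpow_atTop ha3).comp tendsto_natCast_atTop_atTop).eventually_gt_atTop _
  obtain ⟨n, hnC, hn1⟩ := (hev1.and (eventually_ge_atTop 1)).exists
  have hnpos : (0 : ℝ) < n := by exact_mod_cast hn1
  have h1 : 1 / (27 * (n : ℝ) ^ 3) ≤ C * (n : ℝ) ^ (-a) := (fa2_ge_cube p hn1).trans (hC n hn1)
  have hna : 0 < (n : ℝ) ^ a := Real.rpow_pos_of_pos hnpos a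
  rw [Real.rpow_neg hnpos.le a, ← div_eq_mul_inv, le_div_iff₀ hna] at h1
  have h2 : (n : ℝ) ^ (a - 3) = 27 * (1 / (27 * (n : ℝ) ^ 3) * (n : ℝ) ^ a) := by
    rw [Real.rpow_sub hnpos, show ((3 : ℝ)) = ((3 : ℕ) : ℝ) by norm_num, Real.rpow_natCast]
    field_simp
  rw [h2] at hnC
  linarith

/-- The `∀ a > 0` strengthening of the crux is false at every `p` (already at `a = 4`). -/
theorem not_forall_exponent (p : unitInterval) :
    ¬ ∀ a : ℝ, 0 < a → ∃ C : ℝ, ∀ n : ℕ, 1 ≤ n → fa2 p n ≤ C * (n : ℝ) ^ (-a) := by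
  intro h
  obtain ⟨C, hC⟩ := h 4 (by norm_num)
  have := exponent_le_three p hC
  norm_num at this

/-! ## Normal form for provers: eventual bounds suffice -/

/-- An eventual bound `FA₂(p,n) ≤ C n^{-a}` upgrades to all `n ≥ 1` (larger constant). -/
theorem of_eventually {p : unitInterval} {a C : ℝ} (ha : 0 < a)
    (h : ∀ᶠ n : ℕ in atTop, fa2 p n ≤ C * (n : ℝ) ^ (-a)) :
    ∃ C' : ℝ, ∀ n : ℕ, 1 ≤ n → fa2 p n ≤ C' * (n : ℝ) ^ (-a) := by
  obtain ⟨N, hN⟩ := eventually_atTop.1 h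
  set N₁ : ℕ := max N 1 with hN₁
  refine ⟨max C ((N₁ : ℝ) ^ a), fun n hn => ?_⟩
  have hnpos : (0 : ℝ) < n := by exact_mod_cast hn
  have hrpos : 0 ≤ (n : ℝ) ^ (-a) := (Real.rpow_pos_of_pos hnpos _).le
  rcases le_or_gt N n with hNn | hnN
  · calc fa2 p n ≤ C * (n : ℝ) ^ (-a) := hN n hNn
      _ ≤ max C ((N₁ : ℝ) ^ a) * (n : ℝ) ^ (-a) := mul_le_mul_of_nonneg_right (le_max_left _ _) hrpos
  · have hnN₁ : (n : ℝ) ≤ N₁ := by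
      have : n ≤ N₁ := (Nat.le_of_lt hnN).trans (le_max_left _ _)
      exact_mod_cast this
    have hpow : (n : ℝ) ^ a ≤ (N₁ : ℝ) ^ a := Real.rpow_le_rpow hnpos.le hnN₁ ha.le
    have hna : 0 < (n : ℝ) ^ a := Real.rpow_pos_of_pos hnpos a
    calc fa2 p n ≤ 1 := fa2_le_one p n
      _ ≤ (N₁ : ℝ) ^ a * (n : ℝ) ^ (-a) := by
          rw [Real.rpow_neg hnpos.le, ← div_eq_mul_inv, le_div_iff₀ hna, one_mul]
          exact hpow
      _ ≤ max C ((N₁ : ℝ) ^ a) * (n : ℝ) ^ (-a) := mul_le_mul_of_nonneg_right (le_max_right _ _) hrpos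

end

end Summit.CriticalPhenomena.PercolationContinuityZ3.FreeBoxPowerSavingNegative
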